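import Summits.CriticalPhenomena.Ising3D.Control2DTaylorTermwise
import Summits.CriticalPhenomena.Ising3D.Control2DOpeEpsTwoSided
import Summits.CriticalPhenomena.Ising3D.Control2DIslandRect
import Mathlib.Tactic.Linarith
import Mathlib.Tactic.Positivity
import HarnessLib

/-!
# Soundness of the 2D certificate kinds for Taylor (derivative) functionals; the kind-`box` obligations
(cell `pub-ising3x`, seat controls-1 gen 14; KERNEL PATH for the 2D γ (derivative-functional)
certificates, step 1d — CONTROL-ONLY)

HONEST FRAMING: lottery ticket; floor = tightest certified 3D Ising CFT bounds; no exact-solution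
claim without a proof. CONTROL-ONLY (`d = 2`, axiom set `A2D′`); nothing numerical is asserted here.

Every typed soundness theorem of the 2D control so far takes `EvaluationContinuous φ` (finite point
functionals): `GapObligations.gapExcluded`, `OpeObligations.opeBound` (`Control2DBootstrap`),
`OpeA2DObligations.opeUpper/opeLower` (kind `ope2`, `Control2DOpeTwoSided`),
`OpeEpsA2DObligations.opeEpsUpper/opeEpsLower` (kind `ope2eps`, `Control2DOpeEpsTwoSided`), while the
certificates of record since RB-1 (Λ = 11…19) use the derivative functional at `z = z̄ = 1/2`. With
`Control2DTaylorTermwise` (a Taylor functional at a diagonal point acts termwise on the sum rule of every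
datum in the statements' contradiction branches) each gets a `_taylor` twin here, for boot-1's typed
derivative functionals `IsTaylorFunctional x x φ`, `0 < x < 1`:

* `GapObligations.gapExcluded_taylor` (`U > 2Δ_σ`, `Δ_σ < 1`), `OpeObligations.opeBound_taylor`
  (`gap > 2Δ_σ`, `Δ_σ < 1`);
* `OpeA2DObligations.opeUpper_taylor/opeLower_taylor`, `OpeEpsA2DObligations.opeEpsUpper_taylor/
  opeEpsLower_taylor` (`e₁ > 2Δ_σ`, `G > 2Δ_σ`, `Δ_σ < 1` — for the control: `e₁ ≈ 0.98`, `G = 2`,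
  `Δ_σ = 1/8`);
* NEW — the kind-`box` certificates of the class-1 cover (`FORMAT deriv-functional-2d/2`, 23 boxes in
  `RB7/cover_v15.json`) had no typed obligations: `BoxObligations φ s G δ e₁ e₂ E₀` = (I) identity
  positivity, (E) the isolated-`ε` cells, (T) the stress-tensor point, (C′) the gapped cells below `E₀`,
  (R) everything above `E₀`; soundness `BoxObligations.boxExcluded` (evaluation-continuous `φ`),
  `boxExcluded_taylor` (Taylor `φ`, boxes above `2Δ_σ`) and — for ANY box, including the cover's boxes
  below `2Δ_σ = 1/4` — `BoxObligations.excludedOn_taylor : ExcludedOn s G δ (Icc e₁ e₂)`, the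
  location-wise exclusion that `twoSided_of_cover` actually consumes (via the single-location termwise
  theorem `hasSum_taylor_of_location`, no condition on the location); and the D-box (`FORMAT /3`)
  versions `rectExcluded_taylor` / `excludedOn₂_taylor` (one functional, obligations at every
  `Δ_σ ∈ [σ₁, σ₂]`).

So a 2D derivative-functional certificate whose finitely many obligations are established proves the
typed statement of its kind by a Lean theorem; what remains external is the discharge of the
obligations themselves (region `Qa ≥ 0`, cells, (I)/(T) — the readers' exact arithmetic), exactly as for
the RB-0 point-functional certificates before `Control2DEps105`.

Sources: R. Rattazzi, V. S. Rychkov, E. Tonni, A. Vichi, JHEP 12 (2008) 031, §5 (the linear-functional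
argument); A. de la Fuente, arXiv:1904.09801, §2 (the `A2D′` assumptions); tree: the files named above.
-/

namespace Summit.CriticalPhenomena.Ising3D.Control2D

open Set
open Literature.MathematicalPhysics.QuantumFieldTheory.ConformalBootstrap3D

/-! ### Gap and OPE certificates (`Control2DBootstrap`) -/

namespace GapObligations

variable {φ : (ℝ → ℝ → ℝ) →ₗ[ℝ] ℝ} {s U E₀ x : ℝ}

/-- **Soundness of a gap certificate by a Taylor (derivative) functional.** A Taylor functional at a
diagonal point `(x,x)`, `0 < x < 1`, satisfying the gap obligations excludes the gap `U`, provided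
`U > 2Δ_σ` and `Δ_σ < 1` (then every datum of the contradiction branch has all dimensions `> 2Δ_σ`, its
diagonal OPE converges, and `φ` acts termwise: every term `≥ 0`, total `-φ[F_-[1]] < 0`).
[cite: RattazziEtAl2008, §5] -/
theorem gapExcluded_taylor (hφ : IsTaylorFunctional x x φ) (hx0 : 0 < x) (hx1 : x < 1)
    (hU2 : 2 * s < U) (hs1 : s < 1) (h : GapObligations φ s U E₀) : GapExcluded s U := by
  intro D hU hC hgap
  have hs := CrossingData.hasSum_taylor_of_hasScalarGap hφ hx0 hx1 hU hC hgap hU2 hs1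
  have hnn : ∀ i, 0 ≤ D.p i * φ (crossF s (-1) (globalBlock (D.Δ i) (D.spin i))) := fun i =>
    mul_nonneg (hU i).2.2
      (h.blockPositive (D.spin i) (hU i).1 (D.Δ i) (hU i).2.1 (fun h0 => hgap i h0))
  have h0 : (0 : ℝ) ≤ -(φ (crossF s (-1) (fun _ _ => (1 : ℝ)))) := hs.nonneg hnn
  linarith [h.identity_pos]

end GapObligations

namespace OpeObligations

variable {φ : (ℝ → ℝ → ℝ) →ₗ[ℝ] ℝ} {s gap P E₀ x : ℝ}

/-- **Soundness of an OPE certificate by a Taylor functional** (`gap > 2Δ_σ`, `Δ_σ < 1`): termwise,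
`p_T φ[F_T] ≤ ∑ p φ[F] = -φ[F_1] < P φ[F_T]`. [cite: RattazziEtAl2008, §5] -/
theorem opeBound_taylor (hφ : IsTaylorFunctional x x φ) (hx0 : 0 < x) (hx1 : x < 1)
    (hg2 : 2 * s < gap) (hs1 : s < 1) (h : OpeObligations φ s gap P E₀) : OpeBound s gap P := by
  intro D hU hC hgap i hΔ hspin
  have hs := CrossingData.hasSum_taylor_of_hasScalarGap hφ hx0 hx1 hU hC hgap hg2 hs1
  have hnn : ∀ j, 0 ≤ D.p j * φ (crossF s (-1) (globalBlock (D.Δ j) (D.spin j))) := fun j =>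
    mul_nonneg (hU j).2.2
      (h.blockPositive (D.spin j) (hU j).1 (D.Δ j) (hU j).2.1 (fun h0 => hgap j h0))
  have hle : D.p i * φ (crossF s (-1) (globalBlock (D.Δ i) (D.spin i)))
      ≤ -(φ (crossF s (-1) (fun _ _ => (1 : ℝ)))) := le_hasSum hs i (fun j _ => hnn j)
  rw [hΔ, hspin] at hle
  have hT := h.stress_pos
  have hI := h.identity_ope
  by_contra hnot
  have hPle : P ≤ D.p i := not_lt.mp hnot
  have : P * φ (crossF s (-1) (globalBlock 2 2)) ≤
      D.p i * φ (crossF s (-1) (globalBlock 2 ((2 : ℕ)))) :=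
    mul_le_mul_of_nonneg_right hPle hT.le
  linarith

end OpeObligations

/-! ### Kind `box` (`FORMAT deriv-functional-2d/2`): obligations and soundness -/

/-- **The obligations of a kind-`box` certificate** for a functional `φ` at external dimension `s` under
`A2D′` with the isolated-`ε` box `[e₁, e₂]`, scalar gap `G`, spin-2 gap `δ` and the readers' threshold
`E₀` (`FORMAT deriv-functional-2d/2`): (I) `φ[F_-[1]] > 0`; (E) block positivity on the scalars of the
box; (C′) on the scalars in `[G, E₀)`, (T) at the stress-tensor point `(2,2)`, on spin 2 in
`[2 + δ, E₀)`, on even spins `ℓ ≥ 4` with `ℓ ≤ Δ < E₀`; (R) on everything at or above `E₀`.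
[cite: RattazziEtAl2008, §5.5] -/
structure BoxObligations (φ : (ℝ → ℝ → ℝ) →ₗ[ℝ] ℝ) (s G δ e₁ e₂ E₀ : ℝ) : Prop where
  /-- (I) `φ[F_-[𝟙]] > 0`. -/
  identity_pos : 0 < φ (crossF s (-1) (fun _ _ => (1 : ℝ)))
  /-- (E) the isolated-`ε` cells. -/
  box_nonneg : ∀ Δ : ℝ, e₁ ≤ Δ → Δ ≤ e₂ → BlockPositive φ s Δ 0
  /-- (C′) scalars between the gap `G` and the threshold. -/
  scalar_nonneg : ∀ Δ : ℝ, G ≤ Δ → Δ < E₀ → BlockPositive φ s Δ 0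
  /-- (T) the stress-tensor point `(Δ, ℓ) = (2, 2)`. -/
  stress_nonneg : BlockPositive φ s 2 2
  /-- (C′) spin 2 above the spin-2 gap, below the threshold. -/
  spinTwo_nonneg : ∀ Δ : ℝ, 2 + δ ≤ Δ → Δ < E₀ → BlockPositive φ s Δ 2
  /-- (C′) even spins `ℓ ≥ 4` below the threshold (unitarity `Δ ≥ ℓ` only). -/
  spinning_nonneg : ∀ ℓ : ℕ, Even ℓ → ℓ ≠ 0 → ℓ ≠ 2 → ∀ Δ : ℝ, (ℓ : ℝ) ≤ Δ → Δ < E₀ →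
    BlockPositive φ s Δ ℓ
  /-- (R) everything at or above the threshold (all even spins). -/
  high_nonneg : ∀ ℓ : ℕ, Even ℓ → ∀ Δ : ℝ, (ℓ : ℝ) ≤ Δ → E₀ ≤ Δ → BlockPositive φ s Δ ℓ

namespace BoxObligations

variable {φ : (ℝ → ℝ → ℝ) →ₗ[ℝ] ℝ} {s G δ e₁ e₂ E₀ x : ℝ}

/-- Every block of an `A2D′` datum with scalars in `[e₁,e₂] ∪ [G,∞)` is covered by a positivity clause.
Elementary case analysis. [folklore] -/
theorem blockPositive (h : BoxObligations φ s G δ e₁ e₂ E₀) {D : CrossingData} (hU : D.IsUnitary)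
    (hS : D.ScalarsIn (Icc e₁ e₂ ∪ Ici G)) (hT2 : D.SpinTwoIn ({2} ∪ Ici (2 + δ))) (i : D.ι) :
    BlockPositive φ s (D.Δ i) (D.spin i) := by
  obtain ⟨hev, hΔℓ, -⟩ := hU i
  rcases le_or_gt E₀ (D.Δ i) with hge | hlt
  · exact h.high_nonneg _ hev _ hΔℓ hge
  by_cases h0 : D.spin i = 0
  · rw [h0]
    rcases hS i h0 with ⟨h1, h2⟩ | hG
    · exact h.box_nonneg _ h1 h2
    · exact h.scalar_nonneg _ hG hlt
  by_cases h2 : D.spin i = 2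
  · rw [h2]
    rcases hT2 i h2 with hpt | hgap
    · rw [Set.mem_singleton_iff.mp hpt]
      exact h.stress_nonneg
    · exact h.spinTwo_nonneg _ hgap hlt
  · exact h.spinning_nonneg _ hev h0 h2 _ hΔℓ hlt

/-- The contradiction step: a termwise identity `∑ p_i φ[F_i] = -φ[F_1]` with all terms `≥ 0` is
incompatible with (I). [folklore] -/
theorem false_of_hasSum (h : BoxObligations φ s G δ e₁ e₂ E₀) {D : CrossingData} (hU : D.IsUnitary)
    (hS : D.ScalarsIn (Icc e₁ e₂ ∪ Ici G)) (hT2 : D.SpinTwoIn ({2} ∪ Ici (2 + δ)))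
    (hs : HasSum (fun i => D.p i * φ (crossF s (-1) (globalBlock (D.Δ i) (D.spin i))))
      (-(φ (crossF s (-1) (fun _ _ => (1 : ℝ)))))) : False := by
  have hnn : ∀ i, 0 ≤ D.p i * φ (crossF s (-1) (globalBlock (D.Δ i) (D.spin i))) := fun i =>
    mul_nonneg (hU i).2.2 (h.blockPositive hU hS hT2 i)
  have h0 : (0 : ℝ) ≤ -(φ (crossF s (-1) (fun _ _ => (1 : ℝ)))) := hs.nonneg hnn
  linarith [h.identity_pos]

/-- **Soundness of kind `box` for an evaluation-continuous functional** (e.g. a point functional).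
PROVED. [cite: RattazziEtAl2008, §5] -/
theorem boxExcluded (hφ : EvaluationContinuous φ) (h : BoxObligations φ s G δ e₁ e₂ E₀) :
    BoxExcluded s G δ e₁ e₂ := by
  intro D hU hC hS hT2
  exact h.false_of_hasSum hU hS hT2 (OpeA2DObligations.hasSum_apply hφ hC)

/-- **Soundness of kind `box` for a Taylor (derivative) functional, boxes above `2Δ_σ`**: a Taylor
functional at `(x,x)` satisfying the box obligations gives `BoxExcluded s G δ e₁ e₂` provided
`e₁ > 2Δ_σ`, `G > 2Δ_σ`, `Δ_σ < 1`. PROVED. [cite: RattazziEtAl2008, §5] -/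
theorem boxExcluded_taylor (hφ : IsTaylorFunctional x x φ) (hx0 : 0 < x) (hx1 : x < 1)
    (he : 2 * s < e₁) (hG : 2 * s < G) (hs1 : s < 1) (h : BoxObligations φ s G δ e₁ e₂ E₀) :
    BoxExcluded s G δ e₁ e₂ := by
  intro D hU hC hS hT2
  exact h.false_of_hasSum hU hS hT2
    (CrossingData.hasSum_taylor_of_scalarsIn hφ hx0 hx1 hU hC hS he hG hs1)

/-- **Soundness of kind `box` for a Taylor functional, ANY box — location-wise**: a Taylor functional
at `(x,x)` satisfying the box obligations excludes every single `ε` LOCATION in the box,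
`ExcludedOn s G δ (Icc e₁ e₂)` (the input of `twoSided_of_cover` / `excludedOn_Icc_append`), provided
only `G > 2Δ_σ` and `Δ_σ < 1` — no condition on the box, by the single-location termwise theorem
`hasSum_taylor_of_location`. (For data with SEVERAL distinct scalars inside a box below `2Δ_σ` the
derived OPE convergence is not available; the cover never needs that case.) PROVED.
[cite: RattazziEtAl2008, §5] -/
theorem excludedOn_taylor (hφ : IsTaylorFunctional x x φ) (hx0 : 0 < x) (hx1 : x < 1)
    (hG : 2 * s < G) (hs1 : s < 1) (h : BoxObligations φ s G δ e₁ e₂ E₀) :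
    ExcludedOn s G δ (Icc e₁ e₂) := by
  intro x₀ hx₀ D hU hC hS hT2
  have hS' : D.ScalarsIn (Icc e₁ e₂ ∪ Ici G) := by
    refine hS.mono ?_
    intro y hy
    rcases hy with hy | hy
    · left
      rw [mem_singleton_iff.mp hy]
      exact hx₀
    · right
      exact hy
  exact h.false_of_hasSum hU hS' hT2
    (CrossingData.hasSum_taylor_of_location hφ hx0 hx1 hU hC hS hG hs1)

/-- **Kind `box` with a D-box (`FORMAT deriv-functional-2d/3`) for a Taylor functional**: if ONE
Taylor functional at `(x,x)` satisfies the box obligations at EVERY external dimension `s ∈ [σ₁, σ₂]`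
(the readers keep the `Δ_σ` dependence exactly polynomial), then `RectExcluded G δ σ₁ σ₂ e₁ e₂`,
provided `e₁ > 2σ₂`, `G > 2σ₂`, `σ₂ < 1`. PROVED (columnwise `boxExcluded_taylor`).
[cite: RattazziEtAl2008, §5] -/
theorem rectExcluded_taylor {σ₁ σ₂ : ℝ} (hφ : IsTaylorFunctional x x φ) (hx0 : 0 < x) (hx1 : x < 1)
    (he : 2 * σ₂ < e₁) (hG : 2 * σ₂ < G) (hs1 : σ₂ < 1)
    (h : ∀ s ∈ Icc σ₁ σ₂, BoxObligations φ s G δ e₁ e₂ E₀) : RectExcluded G δ σ₁ σ₂ e₁ e₂ :=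
  fun s hs => (h s hs).boxExcluded_taylor hφ hx0 hx1 (by linarith [hs.2]) (by linarith [hs.2])
    (by linarith [hs.2])

/-- **D-box, location-wise, ANY box**: the same hypotheses without a condition on the box give the
pointwise exclusion of every pair of the rectangle, `ExcludedOn₂ G δ ([σ₁,σ₂] × [e₁,e₂])` — the input of
the strip / island cover assembly (`excludedOn₂_slab_of_chain`, `island_of_cover`). PROVED
(columnwise `excludedOn_taylor`). [cite: RattazziEtAl2008, §5] -/
theorem excludedOn₂_taylor {σ₁ σ₂ : ℝ} (hφ : IsTaylorFunctional x x φ) (hx0 : 0 < x) (hx1 : x < 1)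
    (hG : 2 * σ₂ < G) (hs1 : σ₂ < 1)
    (h : ∀ s ∈ Icc σ₁ σ₂, BoxObligations φ s G δ e₁ e₂ E₀) :
    ExcludedOn₂ G δ (Icc σ₁ σ₂ ×ˢ Icc e₁ e₂) := by
  rintro ⟨s, x₀⟩ ⟨hs, hx₀⟩
  exact (h s hs).excludedOn_taylor hφ hx0 hx1 (by linarith [hs.2]) (by linarith [hs.2]) x₀ hx₀

end BoxObligations

/-! ### Kind `ope2` (`Control2DOpeTwoSided`) -/

namespace OpeA2DObligations

variable {φ : (ℝ → ℝ → ℝ) →ₗ[ℝ] ℝ} {s G δ e₁ e₂ P E₀ x : ℝ}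

/-- **Soundness of kind `ope2`, sense upper, for a Taylor functional** (`e₁ > 2Δ_σ`, `G > 2Δ_σ`,
`Δ_σ < 1`). PROVED (termwise sign argument, `indicator_tsum_lt_of_hasSum`).
[cite: RattazziEtAl2008, §5] -/
theorem opeUpper_taylor (hφ : IsTaylorFunctional x x φ) (hx0 : 0 < x) (hx1 : x < 1)
    (he : 2 * s < e₁) (hG : 2 * s < G) (hs1 : s < 1) (h : OpeA2DObligations φ s G δ e₁ e₂ P E₀)
    (hX : 0 < φ (crossF s (-1) (globalBlock 2 2))) : OpeUpperA2D s G δ e₁ e₂ P := by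
  intro D hU hC hS hT2
  unfold CrossingData.stressCoeff
  refine indicator_tsum_lt_of_hasSum D.stressSet
    (CrossingData.hasSum_taylor_of_scalarsIn hφ hx0 hx1 hU hC hS he hG hs1) (fun i => (hU i).2.2)
    (fun i hi => ?_) (fun i hi => h.blockPositive_off_T hU hS hT2 i hi) h.identity_ope hX
  obtain ⟨hΔ, hℓ⟩ := hi
  rw [hΔ, hℓ]

/-- **Soundness of kind `ope2`, sense lower, for a Taylor functional.** PROVED.
[cite: RattazziEtAl2008, §5] -/
theorem opeLower_taylor (hφ : IsTaylorFunctional x x φ) (hx0 : 0 < x) (hx1 : x < 1)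
    (he : 2 * s < e₁) (hG : 2 * s < G) (hs1 : s < 1) (h : OpeA2DObligations φ s G δ e₁ e₂ P E₀)
    (hX : φ (crossF s (-1) (globalBlock 2 2)) < 0) : OpeLowerA2D s G δ e₁ e₂ P := by
  intro D hU hC hS hT2
  unfold CrossingData.stressCoeff
  refine lt_indicator_tsum_of_hasSum D.stressSet
    (CrossingData.hasSum_taylor_of_scalarsIn hφ hx0 hx1 hU hC hS he hG hs1) (fun i => (hU i).2.2)
    (fun i hi => ?_) (fun i hi => h.blockPositive_off_T hU hS hT2 i hi) h.identity_ope hX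
  obtain ⟨hΔ, hℓ⟩ := hi
  rw [hΔ, hℓ]

end OpeA2DObligations

/-! ### Kind `ope2eps` (`Control2DOpeEpsTwoSided`) -/

namespace OpeEpsA2DObligations

variable {φ : (ℝ → ℝ → ℝ) →ₗ[ℝ] ℝ} {s G δ e₁ e₂ P E₀ x : ℝ}

/-- **Soundness of kind `ope2eps`, sense upper, for a Taylor functional** (`e₁ > 2Δ_σ`, `G > 2Δ_σ`,
`Δ_σ < 1`): the obligations plus `φ[F_-[g_{Δ,0}]] > 0` on the box and `P > 0` give `OpeEpsUpperA2D`.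
PROVED (`box_tsum_lt_of_hasSum`). [cite: RattazziEtAl2008, §5] -/
theorem opeEpsUpper_taylor (hφ : IsTaylorFunctional x x φ) (hx0 : 0 < x) (hx1 : x < 1)
    (he : 2 * s < e₁) (hG : 2 * s < G) (hs1 : s < 1)
    (h : OpeEpsA2DObligations φ s G δ e₁ e₂ P E₀) (hP : 0 < P)
    (hX : ∀ Δ : ℝ, e₁ ≤ Δ → Δ ≤ e₂ → 0 < φ (crossF s (-1) (globalBlock Δ 0))) :
    OpeEpsUpperA2D s G δ e₁ e₂ P := by
  intro D hU hC hS hT2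
  unfold CrossingData.boxWeight
  refine (box_tsum_lt_of_hasSum (D.boxSet e₁ e₂) (c := fun i => (2 : ℝ) ^ (-D.Δ i))
    (CrossingData.hasSum_taylor_of_scalarsIn hφ hx0 hx1 hU hC hS he hG hs1) (fun i => (hU i).2.2)
    (fun i _ => Real.rpow_pos_of_pos (by norm_num) _)
    (fun i hi => h.blockPositive_off_box hU hS hT2 i hi) (fun i hi => ?_) (fun i hi => ?_) hP).2
  · obtain ⟨h0, hΔ⟩ := hi
    have := hX (D.Δ i) hΔ.1 hΔ.2
    rwa [h0]
  · obtain ⟨h0, hΔ⟩ := hi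
    have := h.identity_ope (D.Δ i) hΔ.1 hΔ.2
    rwa [h0, div_two_rpow_neg]

/-- **Soundness of kind `ope2eps`, sense lower, for a Taylor functional**: the obligations plus a
uniform negative sign margin `2^Δ φ[F_-[g_{Δ,0}]] ≤ -σ < 0` on the box, a non-empty box and `P > 0` give
`OpeEpsLowerA2D`. PROVED (`lt_box_tsum_of_hasSum`). [cite: RattazziEtAl2008, §5] -/
theorem opeEpsLower_taylor (hφ : IsTaylorFunctional x x φ) (hx0 : 0 < x) (hx1 : x < 1)
    (he : 2 * s < e₁) (hG : 2 * s < G) (hs1 : s < 1)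
    (h : OpeEpsA2DObligations φ s G δ e₁ e₂ P E₀) (hP : 0 < P) (he₁₂ : e₁ ≤ e₂) {σ : ℝ}
    (hσ : 0 < σ)
    (hX : ∀ Δ : ℝ, e₁ ≤ Δ → Δ ≤ e₂ → (2 : ℝ) ^ Δ * φ (crossF s (-1) (globalBlock Δ 0)) ≤ -σ) :
    OpeEpsLowerA2D s G δ e₁ e₂ P := by
  intro D hU hC hS hT2
  unfold CrossingData.boxWeight
  have ha₁ : 0 < φ (crossF s (-1) (fun _ _ => (1 : ℝ))) := by
    have h1 := h.identity_ope e₁ le_rfl he₁₂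
    have h2 := hX e₁ le_rfl he₁₂
    nlinarith
  refine (lt_box_tsum_of_hasSum (D.boxSet e₁ e₂) (c := fun i => (2 : ℝ) ^ (-D.Δ i))
    (CrossingData.hasSum_taylor_of_scalarsIn hφ hx0 hx1 hU hC hS he hG hs1) (fun i => (hU i).2.2)
    (fun i _ => Real.rpow_pos_of_pos (by norm_num) _)
    (fun i hi => h.blockPositive_off_box hU hS hT2 i hi) hσ (fun i hi => ?_) (fun i hi => ?_)
    ha₁ hP).2
  · obtain ⟨h0, hΔ⟩ := hi
    have := hX (D.Δ i) hΔ.1 hΔ.2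
    rwa [h0, div_two_rpow_neg]
  · obtain ⟨h0, hΔ⟩ := hi
    have := h.identity_ope (D.Δ i) hΔ.1 hΔ.2
    rwa [h0, div_two_rpow_neg]

end OpeEpsA2DObligations

end Summit.CriticalPhenomena.Ising3D.Control2D
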